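import Literature.AnabelianGeometry.EtaleTheta.SettingModelThetaEigenStatements
import Literature.AnabelianGeometry.EtaleTheta.SettingModelCuspAxis
import Literature.AnabelianGeometry.EtaleTheta.SettingModelCyclotomicCharacterInvariants
import Literature.AnabelianGeometry.AbsoluteAnabelian.AbsTopII.DehnTwistFreeGroupInputs
import HarnessLib

/-!
# Prop R1b in LINE FORM — the normal form of a torus-intertwining map on the `b`-lines of `F̂₂`
# (PL3-R1A §2.4 (1)(2)(3) + uniqueness, `Û`-free), PROVED MODULO the three slice-1 statements as hypotheses

abc-iut-L6-t19 GEN 22 (PROOF-ONLY file; filed gen 24).  Route-INDEPENDENT: the three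
tree-consuming statements of (L3′) slice 1 — torus-FIXED rigidity (Thm R1 (R1a)), torus-STABLE lines
(Cor R1′) and the twisted-torus COBOUNDARY lemma (Lemma R1b♯) — enter as HYPOTHESES `hFix`, `hStab`,
`hCob` stated relative to a subgroup `V ≤ G_{ℚ_p}` (the torus `U₀` of PL3-R1A §2.4 (d)); they are discharged
by name by whichever route lands them (ROUTE-T `…OfFixedConn` files or ROUTE-PBF T1–T3).

Setting (all tree vocabulary): `F̂₂ = F₂hatT`, `a = η x₀`, `a^s = powHat a s`, `B = bAxis = b^Ẑ`,
`θ_φ = twist φ`, `χ = chi p`.  A map `Λ : F̂₂ → F̂₂` ENCODES a bijection of the set of `b`-lines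
`{x·B·x⁻¹} ↔ F̂₂/B` when it respects right `B`-cosets (`hΛB`), is injective on cosets (`hΛinj`) and hits
every coset (`hΛsurj`); the TORUS INTERTWINING with a `θ`-cocycle `η` on `V` is
`Λ(θ_v·L) = η_v θ_v·Λ(L)`, i.e. `(Λ (θ_v x))⁻¹ · η_v · θ_v (Λ x) ∈ B` (`hΛθ`).  This is exactly what PL3-R1A
§2.4 FACTS (a)(b)(c) extract from a `χ`-law automorphism `Ψ` of `Û` (the `Û`-level dictionary, item (4′),
is NOT in this file).

* `exists_torusNormalForm` — ∃ `f′` with (1) EXACT torus equivariance after the inner correction: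
  `f′⁻¹ · η_v · θ_v(f′) = 1` for all `v ∈ V`; (2a) `f′⁻¹Λ` fixes the line `B`; (2b) `f′⁻¹Λ` maps the axis
  lines `{a^s B}` onto themselves (both directions);
* `torusNormalForm_unique` — `f′` is unique.
(The «B-valued residual Kummer cocycle» (3) of loc. cit. is then immediate from (2a) and the Kummer
intertwining, and is left to the consumer.)  Proof = PL3-R1A §2.4 with CLAIM M NOT used (only `hCob` on the
two stable lines `B`, `aB`, then `hStab`, then `hFix` + `H⁰ = 1` for uniqueness).  Classical group algebra
about OUR model; nothing about [EtTh]/[IUTchII]/[IUTchIII] in print; no side on [IUTchIII] Cor 3.12;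
nothing here asserts abc proved or refuted.
-/

noncomputable section

namespace Literature.AnabelianGeometry.EtaleTheta.SettingModel.TorusNormalForm

open Literature.AnabelianGeometry.EtaleTheta.SettingModel
open Literature.AnabelianGeometry.SemiGraphs (GQp)
open Literature.AnabelianGeometry.AbsoluteAnabelian.AbsTopII

/-! ### Small tools: `a`-powers are `θ`-fixed and meet `B` trivially -/

/-- `θ_φ(a^s) = a^s`. [cite: MochizukiEtTh2009, §1 p.12] -/
theorem twist_powHat_eta_zero (φ : MulAut ZH) (s : ZH) :
    twist φ (powHat (eta (FreeGroup.of 0)) s) = powHat (eta (FreeGroup.of 0)) s := by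
  rw [twist_powHat, twist_eta_of_zero]

/-- `A ∩ B = 1`: an `a`-power lying on the `b`-axis is trivial (it is a `b`-power fixed by every `θ_{χσ}`,
and `H⁰(G_{ℚ_p}, Ẑ(χ)) = 1`). [cite: NeukirchANT1999, Ch. II Prop. (5.7) (i)] -/
theorem powHat_eta_zero_eq_one_of_mem_bAxis (p : ℕ) [Fact p.Prime] {s : ZH}
    (h : powHat (eta (FreeGroup.of 0)) s ∈ bAxis) : powHat (eta (FreeGroup.of 0)) s = 1 := by
  obtain ⟨t, ht⟩ := (mem_bAxis_iff _).1 h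
  have hfix : ∀ σ : GQp p, chi p σ t = t := fun σ => by
    apply bPow_injective
    rw [← twist_bPow, ht, twist_powHat_eta_zero]
  rw [← ht, eq_one_of_forall_chi_apply_eq_top p hfix, map_one]

/-- `a ∉ B`, re-exported from the tree. [cite: MochizukiAbsTopII2013, Ex 1.1 (ii) p.9] -/
theorem eta_zero_not_mem_bAxis' : eta (FreeGroup.of 0) ∉ (bAxis : Subgroup F₂hatT) :=
  DehnTwist.eta_zero_not_mem_bAxis

/-! ### The hypotheses (the three slice-1 statements, relative to the torus `V`) -/

section NormalForm

variable (p : ℕ) [Fact p.Prime] (V : Subgroup (GQp p))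

/-- Algebra: `x⁻¹ · (f θ(f)⁻¹) · θ(x) = (f⁻¹x)⁻¹ · θ(f⁻¹x)`. [folklore] -/
private theorem inv_mul_coboundary_mul_twist (φ : MulAut ZH) (f x : F₂hatT) :
    x⁻¹ * (f * (twist φ f)⁻¹ * twist φ x) = (f⁻¹ * x)⁻¹ * twist φ (f⁻¹ * x) := by
  rw [map_mul, map_inv]
  group

/-- **Prop R1b, line form (existence).**  Under two of the three slice-1 statements for the torus `V`
(`hStab` = Cor R1′, `hCob` = Lemma R1b♯ — Thm R1 itself is needed only for uniqueness), a map `Λ` on `b`-lines intertwining the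
torus `θ_V` with its `η`-twist admits an inner correction `f′` after which (1) the torus intertwining is
EXACT, (2a) the line `B` is fixed, (2b) the axis lines `a^s B` are permuted. [cite: MochizukiEtTh2009, §1 p.12] -/
theorem exists_torusNormalForm
    (hStab : ∀ x : F₂hatT, (∀ v ∈ V, x⁻¹ * twist (chi p v) x ∈ bAxis) →
      ∃ s t : ZH, x = powHat (eta (FreeGroup.of 0)) s * bPow t)
    (hCob : ∀ η : GQp p → F₂hatT,
      (∀ u ∈ V, ∀ v ∈ V, η (u * v) = η u * twist (chi p u) (η v)) →
      ∀ x₁ x₂ : F₂hatT,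
        (∀ v ∈ V, x₁⁻¹ * (η v * twist (chi p v) x₁) ∈ bAxis) →
        (∀ v ∈ V, x₂⁻¹ * (η v * twist (chi p v) x₂) ∈ bAxis) →
        x₁⁻¹ * x₂ ∉ bAxis → ∃ y : F₂hatT, ∀ v ∈ V, η v = y * (twist (chi p v) y)⁻¹)
    (η : GQp p → F₂hatT) (hη : ∀ u ∈ V, ∀ v ∈ V, η (u * v) = η u * twist (chi p u) (η v))
    (Λ : F₂hatT → F₂hatT)
    (hΛB : ∀ x y : F₂hatT, x⁻¹ * y ∈ bAxis → (Λ x)⁻¹ * Λ y ∈ bAxis)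
    (hΛinj : ∀ x y : F₂hatT, (Λ x)⁻¹ * Λ y ∈ bAxis → x⁻¹ * y ∈ bAxis)
    (hΛsurj : ∀ y : F₂hatT, ∃ x : F₂hatT, (Λ x)⁻¹ * y ∈ bAxis)
    (hΛθ : ∀ v ∈ V, ∀ x : F₂hatT,
      (Λ (twist (chi p v) x))⁻¹ * (η v * twist (chi p v) (Λ x)) ∈ bAxis) :
    ∃ f : F₂hatT,
      (∀ v ∈ V, f⁻¹ * (η v * twist (chi p v) f) = 1) ∧
      (f⁻¹ * Λ 1 ∈ bAxis) ∧
      (∀ s : ZH, ∃ s' : ZH,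
        (powHat (eta (FreeGroup.of 0)) s')⁻¹ * (f⁻¹ * Λ (powHat (eta (FreeGroup.of 0)) s)) ∈ bAxis) ∧
      (∀ s' : ZH, ∃ s : ZH,
        (powHat (eta (FreeGroup.of 0)) s')⁻¹ * (f⁻¹ * Λ (powHat (eta (FreeGroup.of 0)) s)) ∈ bAxis) := by
  -- the images of the two `θ_V`-stable lines `B` and `aB` are `θ^η_V`-stable
  have h₁ : ∀ v ∈ V, (Λ 1)⁻¹ * (η v * twist (chi p v) (Λ 1)) ∈ bAxis := fun v hv => by
    simpa only [map_one] using hΛθ v hv 1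
  have h₂ : ∀ v ∈ V, (Λ (eta (FreeGroup.of 0)))⁻¹ *
      (η v * twist (chi p v) (Λ (eta (FreeGroup.of 0)))) ∈ bAxis := fun v hv => by
    simpa only [twist_eta_of_zero] using hΛθ v hv (eta (FreeGroup.of 0))
  -- and distinct
  have hne : (Λ 1)⁻¹ * Λ (eta (FreeGroup.of 0)) ∉ bAxis := fun h => by
    have h' := hΛinj 1 _ h
    rw [inv_one, one_mul] at h'
    exact eta_zero_not_mem_bAxis' h'
  -- Lemma R1b♯: `η` is a coboundary `η_v = f θ_v(f)⁻¹`
  obtain ⟨f, hf⟩ := hCob η hη (Λ 1) (Λ (eta (FreeGroup.of 0))) h₁ h₂ hne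
  -- Cor R1′ applied to `f⁻¹ Λ(a^s)`: the line `Λ(a^s B)` is an `f`-translate of an axis line
  have key : ∀ s : ZH, ∃ s₀ t₀ : ZH,
      f⁻¹ * Λ (powHat (eta (FreeGroup.of 0)) s) = powHat (eta (FreeGroup.of 0)) s₀ * bPow t₀ := by
    intro s
    apply hStab
    intro v hv
    have h := hΛθ v hv (powHat (eta (FreeGroup.of 0)) s)
    rw [twist_powHat_eta_zero, hf v hv, inv_mul_coboundary_mul_twist] at h
    exact h
  -- in particular at `s` with `a^s = 1`… we use `Λ 1` directly:
  have key1 : ∃ s₀ t₀ : ZH, f⁻¹ * Λ 1 = powHat (eta (FreeGroup.of 0)) s₀ * bPow t₀ := by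
    apply hStab
    intro v hv
    have h := h₁ v hv
    rw [hf v hv, inv_mul_coboundary_mul_twist] at h
    exact h
  obtain ⟨s₀, t₀, h10⟩ := key1
  -- the corrected conjugator
  refine ⟨f * powHat (eta (FreeGroup.of 0)) s₀, ?_, ?_, ?_, ?_⟩
  · -- (1) exact torus equivariance
    intro v hv
    rw [hf v hv, map_mul, twist_powHat_eta_zero]
    group
  · -- (2a) `f′⁻¹ Λ 1 = b^{t₀}`
    have : (f * powHat (eta (FreeGroup.of 0)) s₀)⁻¹ * Λ 1 = bPow t₀ := by
      rw [mul_inv_rev, mul_assoc, h10]; group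
    rw [this]
    exact ⟨t₀, rfl⟩
  · -- (2b, →) `f′⁻¹ Λ(a^s B)` is an axis line
    intro s
    obtain ⟨s₁, t₁, h1⟩ := key s
    refine ⟨s₀⁻¹ * s₁, ?_⟩
    have : (powHat (eta (FreeGroup.of 0)) (s₀⁻¹ * s₁))⁻¹ *
        ((f * powHat (eta (FreeGroup.of 0)) s₀)⁻¹ * Λ (powHat (eta (FreeGroup.of 0)) s)) = bPow t₁ := by
      rw [mul_inv_rev, mul_assoc ((powHat (eta (FreeGroup.of 0)) s₀)⁻¹), h1, map_mul, map_inv]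
      group
    rw [this]
    exact ⟨t₁, rfl⟩
  · -- (2b, ←) every axis line is hit
    intro s'
    -- the target line `y·B`, `y := f′ a^{s'}`, is `θ^η_V`-stable; pull it back along `Λ`
    set y : F₂hatT := f * powHat (eta (FreeGroup.of 0)) s₀ * powHat (eta (FreeGroup.of 0)) s' with hy
    obtain ⟨x, hx⟩ := hΛsurj y
    -- `x·B` is `θ_V`-stable
    have hxstab : ∀ v ∈ V, x⁻¹ * twist (chi p v) x ∈ bAxis := by
      intro v hv
      have hint := hΛθ v hv x
      -- `η_v θ_v(y) = y`
      have hyfix : η v * twist (chi p v) y = y := by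
        rw [hy, hf v hv, map_mul, map_mul, twist_powHat_eta_zero, twist_powHat_eta_zero]
        group
      -- write `Λ x = y · β`, `β ∈ B`
      have hβ : y⁻¹ * Λ x ∈ bAxis := by
        have := bAxis.inv_mem hx
        simpa only [mul_inv_rev, inv_inv] using this
      have hθβ : twist (chi p v) (y⁻¹ * Λ x) ∈ bAxis := twist_mem_bAxis _ hβ
      -- `(Λ θx)⁻¹ · η_v θ_v(Λ x) = (Λ θx)⁻¹ y · θ_v(y⁻¹ Λ x)`
      have hyfix' : y * (twist (chi p v) y)⁻¹ = η v := by
        rw [mul_inv_eq_iff_eq_mul]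
        exact hyfix.symm
      have hrew : (Λ (twist (chi p v) x))⁻¹ * (η v * twist (chi p v) (Λ x)) =
          ((Λ (twist (chi p v) x))⁻¹ * y) * twist (chi p v) (y⁻¹ * Λ x) := by
        rw [map_mul, map_inv, ← hyfix']
        group
      rw [hrew] at hint
      have h3 : (Λ (twist (chi p v) x))⁻¹ * y ∈ bAxis := by
        have := bAxis.mul_mem hint (bAxis.inv_mem hθβ)
        simpa only [mul_inv_cancel_right] using this
      -- hence `(Λ θx)⁻¹ Λ x ∈ B`, so `(θx)⁻¹ x ∈ B`
      have h4 : (Λ (twist (chi p v) x))⁻¹ * Λ x ∈ bAxis := by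
        have := bAxis.mul_mem h3 hβ
        simpa only [mul_assoc, mul_inv_cancel_left] using this
      have h5 := hΛinj _ _ h4
      have := bAxis.inv_mem h5
      simpa only [mul_inv_rev, inv_inv] using this
    obtain ⟨s, t, hxt⟩ := hStab x hxstab
    refine ⟨s, ?_⟩
    -- `Λ(a^s) ∈ Λ(x)·B = y·B`
    have h6 : (Λ (powHat (eta (FreeGroup.of 0)) s))⁻¹ * Λ x ∈ bAxis := by
      apply hΛB
      rw [hxt]
      have : (powHat (eta (FreeGroup.of 0)) s)⁻¹ * (powHat (eta (FreeGroup.of 0)) s * bPow t) = bPow t := by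
        group
      rw [this]; exact ⟨t, rfl⟩
    have h7 : (Λ (powHat (eta (FreeGroup.of 0)) s))⁻¹ * y ∈ bAxis := by
      have := bAxis.mul_mem h6 hx
      simpa only [mul_assoc, mul_inv_cancel_left] using this
    have h8 := bAxis.inv_mem h7
    rw [mul_inv_rev, inv_inv, hy] at h8
    simpa only [mul_inv_rev, mul_assoc] using h8

/-- **Prop R1b, line form (uniqueness).**  Two inner corrections both making the torus intertwining
exact and both fixing the line `B` coincide (`Fix(θ_V) = A` and `A ∩ B = 1`). [cite: MochizukiEtTh2009, §1 p.12] -/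
theorem torusNormalForm_unique
    (hFix : ∀ w : F₂hatT, (∀ v ∈ V, twist (chi p v) w = w) →
      ∃ s : ZH, w = powHat (eta (FreeGroup.of 0)) s)
    (η : GQp p → F₂hatT) (Λ : F₂hatT → F₂hatT) {f₁ f₂ : F₂hatT}
    (h₁ : ∀ v ∈ V, f₁⁻¹ * (η v * twist (chi p v) f₁) = 1) (h₁B : f₁⁻¹ * Λ 1 ∈ bAxis)
    (h₂ : ∀ v ∈ V, f₂⁻¹ * (η v * twist (chi p v) f₂) = 1) (h₂B : f₂⁻¹ * Λ 1 ∈ bAxis) :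
    f₁ = f₂ := by
  -- `φ := f₂⁻¹ f₁` is `θ_V`-fixed
  have hφ : ∀ v ∈ V, twist (chi p v) (f₂⁻¹ * f₁) = f₂⁻¹ * f₁ := by
    intro v hv
    have e₁ : η v = f₁ * (twist (chi p v) f₁)⁻¹ := by
      have := h₁ v hv
      rw [inv_mul_eq_one] at this
      rw [eq_mul_inv_iff_mul_eq]
      exact this.symm
    have e₂ : η v = f₂ * (twist (chi p v) f₂)⁻¹ := by
      have := h₂ v hv
      rw [inv_mul_eq_one] at this
      rw [eq_mul_inv_iff_mul_eq]
      exact this.symm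
    rw [map_mul, map_inv]
    have e := e₁.symm.trans e₂
    -- `f₁ θ(f₁)⁻¹ = f₂ θ(f₂)⁻¹`
    calc (twist (chi p v) f₂)⁻¹ * twist (chi p v) f₁
        = f₂⁻¹ * (f₂ * (twist (chi p v) f₂)⁻¹) * twist (chi p v) f₁ := by group
      _ = f₂⁻¹ * (f₁ * (twist (chi p v) f₁)⁻¹) * twist (chi p v) f₁ := by rw [← e]
      _ = f₂⁻¹ * f₁ := by group
  obtain ⟨s, hs⟩ := hFix _ hφ
  -- and lies on `B`
  have hB : f₂⁻¹ * f₁ ∈ bAxis := by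
    have := bAxis.mul_mem h₂B (bAxis.inv_mem h₁B)
    simpa only [mul_inv_rev, inv_inv, mul_assoc, mul_inv_cancel_left] using this
  rw [hs] at hB
  have h1 := powHat_eta_zero_eq_one_of_mem_bAxis p hB
  rw [← hs, inv_mul_eq_one] at h1
  exact h1.symm

end NormalForm

end Literature.AnabelianGeometry.EtaleTheta.SettingModel.TorusNormalForm

end
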